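import Mathlib.LinearAlgebra.BilinearForm.Properties
import Mathlib.LinearAlgebra.Dual.Lemmas

/-!
# Route LinearSystemTorelli — crux `LocalTubeSpan` (stmt-HodgeConjecture-2490): functionals vanishing on the radical

Helper file (`--supports stmt-HodgeConjecture-2490`, line `Sketch` of the crux chain, cycle 6
"Schnell's Lemma 11 for degenerate lattices from the nondegenerate case", stub
`stub_functionalOfAnnihilator`).

The line reduces the crux ("local Schnell theorem", C. Schnell, *Primitive cohomology and the tube
mapping*, Math. Z. 268 (2010) §3, §7) to Schnell's Lemma 11 (a finite-index "frame" subgroup of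
the monodromy group `Γ_Δ` of a skew vanishing lattice).  Cycle 6 proves Lemma 11 for DEGENERATE
lattices from the nondegenerate case; the unipotent part of `Γ_Δ` consists of shears
`x ↦ x + φ(x) β` with `β` in the radical `R = ker B` and `φ` a linear functional vanishing on `R`,
and to see that the shears realised in the monodromy group exhaust `Hom(V/R, R)` the lead needs
that every such functional is a pairing functional `⟨·, v⟩`.  This file is that piece of linear
algebra:

* `localTubeSpan_functionalOfAnnihilator` — for a bilinear form `B` on a finite-dimensional
  `ℚ`-space `V` and a functional `φ : V → ℚ` vanishing on `ker B = {r | B r = 0}` (the left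
  radical), there is `v ∈ V` with `φ x = B x v` for all `x`.

Proof: the range of `v ↦ B(·, v)` (Mathlib's `B.flip`) is exactly the annihilator of `ker B` in the
dual space — both have dimension `dim V - dim ker B` ("row rank = column rank"); this is Mathlib's
`LinearMap.dualAnnihilator_ker_eq_range_flip` (finite-dimensional spaces are reflexive).  The stub's
interface carries the hypothesis that `B` is alternating (the forms of the line are skew, and then
the left and right radicals agree), but the statement holds for every bilinear form and the proof
does not use it.

Mathlib only; no named facts, no `sorry`.  Deliberately NOT here: anything about lattices, shears or
monodromy (the neighbouring stubs of the line).
-/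

-- `Summit.HodgeConjecture.HodgeConjecture.Theorems` is the mandated namespace (single-conjunct summit:
-- Sub = Summit), which `linter.dupNamespace` flags on every declaration; the lakefile turns the
-- linter off tree-wide (weak option), restated here so stand-alone elaboration is warning-free too.
set_option linter.dupNamespace false

noncomputable section

namespace Summit.HodgeConjecture.HodgeConjecture.Theorems

/-- **Functionals vanishing on the radical are pairing functionals** (stub
`stub_functionalOfAnnihilator` of the line `Sketch`).  Let `B` be a bilinear form on a
finite-dimensional `ℚ`-vector space `V` and `φ : V →ₗ[ℚ] ℚ` a linear functional with `φ r = 0` for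
every `r` in the (left) radical `ker B = {r | B r · = 0}`.  Then `φ = B(·, v)` for some `v ∈ V`:
the range of `v ↦ B(·, v)` is the annihilator of `ker B` (both have dimension `dim V - dim ker B`,
Mathlib's `LinearMap.dualAnnihilator_ker_eq_range_flip`).  The hypothesis `hB` (`B` alternating, as
are the skew forms of the line, so that left and right radicals coincide) is part of the stub's
interface but is not needed and not used by the proof. [folklore] -/
theorem localTubeSpan_functionalOfAnnihilator {V : Type} [AddCommGroup V] [Module ℚ V]
    [FiniteDimensional ℚ V] (B : LinearMap.BilinForm ℚ V)
    (hB : B.IsAlt) (φ : V →ₗ[ℚ] ℚ) (hφ : ∀ r ∈ LinearMap.ker B, φ r = 0) :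
    ∃ v : V, ∀ x : V, φ x = B x v := by
  have _ := hB -- interface hypothesis, deliberately unused (see the docstring)
  -- `φ` annihilates `ker B`, and `(ker B)⁰ = range B.flip`
  have hmem : φ ∈ (LinearMap.ker B).dualAnnihilator := (Submodule.mem_dualAnnihilator φ).2 hφ
  rw [LinearMap.dualAnnihilator_ker_eq_range_flip] at hmem
  obtain ⟨v, hv⟩ := hmem
  exact ⟨v, fun x => by rw [← hv, LinearMap.flip_apply]⟩

end Summit.HodgeConjecture.HodgeConjecture.Theorems
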